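import Mathlib
import Literature.MathematicalPhysics.StatisticalMechanics.BarlowStacking
import Literature.MathematicalPhysics.StatisticalMechanics.LennardJonesClusters
import Literature.MathematicalPhysics.StatisticalMechanics.SeparatedShellSums
import HarnessLib

/-!
# Lattice points of a triangular layer in lateral discs and annuli

Companion of `BarlowStacking.lean` and `SeparatedShellSums.lean`: elementary counting of the
points `barlowPos a h s m i j` of ONE layer `m` of a Barlow stacking (a translate of the planar
triangular lattice `ℤu + ℤv` of spacing `a > 0`, in the horizontal plane `x₃ = m h`) by their
LATERAL distance `√((p 0 - c 0)² + (p 1 - c 1)²)` to a centre `c ∈ ℝ³` — the generic input of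
the rim and disc-count estimates of the restacking competitor of `stmt-AtomisticToContinuum-14296`
(crux `StackingFaultSparsity`), where the moved region is a vertical cylinder.

(The CYLINDER count over the layers `q₁ < n < q₂` about a stacking point is
`MatchedWindowTransfer.card_le_of_lateral_sq_le`; here the centre is arbitrary and the layer is
one.) All bounds come from the dimension-generic volume packing lemmas
`card_le_of_separated_of_dist_le` / `card_le_of_separated_of_mem_shell` applied in
`EuclideanSpace ℝ (Fin 2)` to the lateral projections `(p 0, p 1)` of the layer points, which are
`a`-separated (`le_dist_barlowPos_of_ne`; within a layer the distance IS the lateral distance):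

* `card_layer_le_of_lateral_sq_le` — at most `(2r/a + 1)²` layer points at lateral distance `≤ r`;
* `card_le_of_lateral_mem_shell`, `card_le_of_lateral_mem_shell'` — at most
  `(2r₂/a + 1)² - max(2r₁/a - 1, 0)² ≤ 4 (2r₂/a + 1)((r₂ - r₁)/a + 1)` in the lateral annulus
  `r₁ ≤ · ≤ r₂` (LINEAR in the radius for unit thickness);
* `exists_box_lateral_sq_le` — at least `(r / 2a)²` layer points at lateral distance `≤ r` from a
  layer point (an index box);
* `sum_le_of_lateral_depth_bound` — DEPTH SUMMATION: if a function on the layer points of the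
  disc of radius `r` is `≤ A · max(depth - t₀, 1/2)⁻³`, `depth = r - lateral distance`, its sum is
  `≤ 4 (2r/a + 1)(1/a + 1)(8 t₀ + 18) · A` (unit annuli hold `O(r)` points, `∑_k k⁻³ ≤ 2`);
* `lateral_barlowPos_eq_of_haggLabel` and `abs_card_sub_card_lateral_le` — two layers are
  lateral translates of each other (by `≤ 2a`), so their disc counts differ by at most the
  number of points of an annulus of width `4a`: `≤ 20 (2r/a + 5)`.

Elementary ([folklore]: volume packing, e.g. the argument of Mathlib's
`Besicovitch.card_le_of_separated`).
-/

noncomputable section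

open Finset Metric

namespace Literature.MathematicalPhysics.StatisticalMechanics

section Layer

variable {a h : ℝ} (s : ℤ → ℤ)

/-! ## Lateral geometry of one layer -/

/-- The distance of the lateral projections `(p 0, p 1)`, `(q 0, q 1)` in the Euclidean plane.
[folklore] -/
theorem dist_lateral_eq_sqrt (p q : EuclideanSpace ℝ (Fin 3)) :
    dist ((!₂[p 0, p 1]) : EuclideanSpace ℝ (Fin 2)) (!₂[q 0, q 1]) =
      √((p 0 - q 0) ^ 2 + (p 1 - q 1) ^ 2) := by
  rw [EuclideanSpace.dist_eq, Fin.sum_univ_two]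
  simp [Real.dist_eq, sq_abs]

/-- Within a layer the squared distance is the squared lateral distance. [folklore] -/
theorem dist_barlowPos_same_layer_sq (a h : ℝ) (m i j i' j' : ℤ) :
    dist (barlowPos a h s m i j) (barlowPos a h s m i' j') ^ 2 =
      (barlowPos a h s m i j 0 - barlowPos a h s m i' j' 0) ^ 2 +
        (barlowPos a h s m i j 1 - barlowPos a h s m i' j' 1) ^ 2 := by
  rw [EuclideanSpace.dist_sq_eq, Fin.sum_univ_three, Real.dist_eq, Real.dist_eq, Real.dist_eq,
    sq_abs, sq_abs, sq_abs, barlowPos_apply_two, barlowPos_apply_two]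
  ring

/-- The squared lateral distance of two points of one layer in the indices:
`a² (Δi² + Δi Δj + Δj²)`. [folklore] -/
theorem lateral_sq_barlowPos_same_layer (a h : ℝ) (m i j i' j' : ℤ) :
    (barlowPos a h s m i j 0 - barlowPos a h s m i' j' 0) ^ 2 +
        (barlowPos a h s m i j 1 - barlowPos a h s m i' j' 1) ^ 2 =
      a ^ 2 * (((i : ℝ) - i') ^ 2 + ((i : ℝ) - i') * ((j : ℝ) - j') + ((j : ℝ) - j') ^ 2) := by
  have h3 : (√3 : ℝ) ^ 2 = 3 := Real.sq_sqrt (by norm_num)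
  simp only [barlowPos_apply_zero, barlowPos_apply_one]
  linear_combination (a ^ 2 * ((j : ℝ) - j') ^ 2 / 4) * h3

/-- Lateral projections of distinct points of one layer are `≥ a` apart (`0 ≤ a`). [folklore] -/
theorem le_dist_lateral_barlowPos (ha : 0 ≤ a) {m i j i' j' : ℤ} (hne : (i, j) ≠ (i', j')) :
    a ≤ dist ((!₂[barlowPos a h s m i j 0, barlowPos a h s m i j 1]) : EuclideanSpace ℝ (Fin 2))
      (!₂[barlowPos a h s m i' j' 0, barlowPos a h s m i' j' 1]) := by
  have h1 : √((barlowPos a h s m i j 0 - barlowPos a h s m i' j' 0) ^ 2 +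
      (barlowPos a h s m i j 1 - barlowPos a h s m i' j' 1) ^ 2) =
      dist (barlowPos a h s m i j) (barlowPos a h s m i' j') := by
    rw [← dist_barlowPos_same_layer_sq, Real.sqrt_sq dist_nonneg]
  rw [dist_lateral_eq_sqrt, h1]
  exact le_dist_barlowPos_of_ne a h s ha hne

/-! ## Packing counts -/

/-- **Layer points in a lateral disc**: indices `(i, j)` whose layer point is at lateral distance
`≤ r` from `c` number at most `(2r/a + 1)²` (planar packing of `a`-separated points). [folklore] -/
theorem card_layer_le_of_lateral_sq_le (ha : 0 < a) (m : ℤ) (c : EuclideanSpace ℝ (Fin 3)) {r : ℝ}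
    (hr : 0 ≤ r) (S : Finset (ℤ × ℤ))
    (hS : ∀ ij ∈ S, (barlowPos a h s m ij.1 ij.2 0 - c 0) ^ 2 +
      (barlowPos a h s m ij.1 ij.2 1 - c 1) ^ 2 ≤ r ^ 2) :
    (S.card : ℝ) ≤ (2 * r / a + 1) ^ 2 := by
  classical
  set π : ℤ × ℤ → EuclideanSpace ℝ (Fin 2) := fun ij =>
    !₂[barlowPos a h s m ij.1 ij.2 0, barlowPos a h s m ij.1 ij.2 1] with hπ
  have hsep : ∀ ij ij' : ℤ × ℤ, ij ≠ ij' → a ≤ dist (π ij) (π ij') := fun ij ij' hne =>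
    le_dist_lateral_barlowPos s ha.le (by simpa only [Prod.mk.eta] using hne)
  have hinj : Set.InjOn π S := fun ij _ ij' _ hππ => by
    by_contra hne
    have h1 := hsep ij ij' hne
    rw [hππ, dist_self] at h1
    linarith
  rw [← Finset.card_image_of_injOn hinj]
  have key := card_le_of_separated_of_dist_le (S.image π)
    ((!₂[c 0, c 1]) : EuclideanSpace ℝ (Fin 2)) ha hr ?_ ?_
  · simpa [finrank_euclideanSpace_fin] using key
  · intro p hp
    obtain ⟨ij, hij, rfl⟩ := Finset.mem_image.1 hp
    simp only [hπ]
    rw [dist_lateral_eq_sqrt (barlowPos a h s m ij.1 ij.2) c]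
    calc √((barlowPos a h s m ij.1 ij.2 0 - c 0) ^ 2 + (barlowPos a h s m ij.1 ij.2 1 - c 1) ^ 2)
        ≤ √(r ^ 2) := Real.sqrt_le_sqrt (hS ij hij)
      _ = r := Real.sqrt_sq hr
  · intro p hp p' hp' hne
    obtain ⟨ij, -, rfl⟩ := Finset.mem_image.1 hp
    obtain ⟨ij', -, rfl⟩ := Finset.mem_image.1 hp'
    exact hsep ij ij' fun h0 => hne (by rw [h0])

/-- **Layer points in a lateral annulus**: indices whose layer point is at lateral distance in
`[r₁, r₂]` from `c` (`r₁ ≤ r₂`, `0 ≤ r₂`) number at most `(2r₂/a + 1)² - max(2r₁/a - 1, 0)²`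
(planar shell packing). [folklore] -/
theorem card_le_of_lateral_mem_shell (ha : 0 < a) (m : ℤ) (c : EuclideanSpace ℝ (Fin 3))
    {r₁ r₂ : ℝ} (hr₂ : 0 ≤ r₂) (hr : r₁ ≤ r₂) (S : Finset (ℤ × ℤ))
    (hS : ∀ ij ∈ S, r₁ ≤ √((barlowPos a h s m ij.1 ij.2 0 - c 0) ^ 2 +
        (barlowPos a h s m ij.1 ij.2 1 - c 1) ^ 2) ∧
      √((barlowPos a h s m ij.1 ij.2 0 - c 0) ^ 2 +
        (barlowPos a h s m ij.1 ij.2 1 - c 1) ^ 2) ≤ r₂) :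
    (S.card : ℝ) ≤ (2 * r₂ / a + 1) ^ 2 - (max (2 * r₁ / a - 1) 0) ^ 2 := by
  classical
  set π : ℤ × ℤ → EuclideanSpace ℝ (Fin 2) := fun ij =>
    !₂[barlowPos a h s m ij.1 ij.2 0, barlowPos a h s m ij.1 ij.2 1] with hπ
  have hsep : ∀ ij ij' : ℤ × ℤ, ij ≠ ij' → a ≤ dist (π ij) (π ij') := fun ij ij' hne =>
    le_dist_lateral_barlowPos s ha.le (by simpa only [Prod.mk.eta] using hne)
  have hinj : Set.InjOn π S := fun ij _ ij' _ hππ => by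
    by_contra hne
    have h1 := hsep ij ij' hne
    rw [hππ, dist_self] at h1
    linarith
  rw [← Finset.card_image_of_injOn hinj]
  have key := card_le_of_separated_of_mem_shell (S.image π)
    ((!₂[c 0, c 1]) : EuclideanSpace ℝ (Fin 2)) ha hr₂ hr ?_ ?_
  · simpa [finrank_euclideanSpace_fin] using key
  · intro p hp
    obtain ⟨ij, hij, rfl⟩ := Finset.mem_image.1 hp
    simp only [hπ]
    rw [dist_lateral_eq_sqrt (barlowPos a h s m ij.1 ij.2) c]
    exact hS ij hij
  · intro p hp p' hp' hne
    obtain ⟨ij, -, rfl⟩ := Finset.mem_image.1 hp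
    obtain ⟨ij', -, rfl⟩ := Finset.mem_image.1 hp'
    exact hsep ij ij' fun h0 => hne (by rw [h0])

/-- The annulus count in linear form: `≤ 4 (2r₂/a + 1) ((r₂ - r₁)/a + 1)` — `O(r₂)` points for
bounded thickness `r₂ - r₁`. [folklore] -/
theorem card_le_of_lateral_mem_shell' (ha : 0 < a) (m : ℤ) (c : EuclideanSpace ℝ (Fin 3))
    {r₁ r₂ : ℝ} (hr₂ : 0 ≤ r₂) (hr : r₁ ≤ r₂) (S : Finset (ℤ × ℤ))
    (hS : ∀ ij ∈ S, r₁ ≤ √((barlowPos a h s m ij.1 ij.2 0 - c 0) ^ 2 +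
        (barlowPos a h s m ij.1 ij.2 1 - c 1) ^ 2) ∧
      √((barlowPos a h s m ij.1 ij.2 0 - c 0) ^ 2 +
        (barlowPos a h s m ij.1 ij.2 1 - c 1) ^ 2) ≤ r₂) :
    (S.card : ℝ) ≤ 4 * (2 * r₂ / a + 1) * ((r₂ - r₁) / a + 1) := by
  refine (card_le_of_lateral_mem_shell s ha m c hr₂ hr S hS).trans ?_
  have hX : 0 < 2 * r₂ / a + 1 := by positivity
  have hXY : (2 * r₂ / a + 1) - (2 * r₁ / a - 1) = 2 * ((r₂ - r₁) / a + 1) := by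
    field_simp
    ring
  have hYX : 2 * r₁ / a - 1 ≤ 2 * r₂ / a + 1 := by
    have : 2 * r₁ / a ≤ 2 * r₂ / a := by
      apply div_le_div_of_nonneg_right _ ha.le
      linarith
    linarith
  rcases le_or_gt 0 (2 * r₁ / a - 1) with hY | hY
  · rw [max_eq_left hY]
    nlinarith
  · rw [max_eq_right hY.le]
    nlinarith

/-- **Layer points near a layer point**: at least `(r / 2a)²` points of layer `m` lie at lateral
distance `≤ r` from the point `(i₀, j₀)` of that layer (the index box `|i - i₀|, |j - j₀| ≤ ⌊r/2a⌋`: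
`|Δi u + Δj v|² = a²(Δi² + Δi Δj + Δj²) ≤ 3 a² ⌊r/2a⌋² ≤ r²`). [folklore] -/
theorem exists_box_lateral_sq_le (ha : 0 < a) (m i₀ j₀ : ℤ) {r : ℝ} (hr : 0 ≤ r) :
    ∃ S : Finset (ℤ × ℤ),
      (∀ ij ∈ S, (barlowPos a h s m ij.1 ij.2 0 - barlowPos a h s m i₀ j₀ 0) ^ 2 +
        (barlowPos a h s m ij.1 ij.2 1 - barlowPos a h s m i₀ j₀ 1) ^ 2 ≤ r ^ 2) ∧
      (r / (2 * a)) ^ 2 ≤ S.card := by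
  set M : ℕ := ⌊r / (2 * a)⌋₊ with hM
  have hM0 : (0 : ℝ) ≤ r / (2 * a) := by positivity
  have hMle : (M : ℝ) ≤ r / (2 * a) := Nat.floor_le hM0
  have hMlt : r / (2 * a) < M + 1 := Nat.lt_floor_add_one _
  refine ⟨Finset.Icc (i₀ - M) (i₀ + M) ×ˢ Finset.Icc (j₀ - M) (j₀ + M), fun ij hij => ?_, ?_⟩
  · rw [Finset.mem_product, Finset.mem_Icc, Finset.mem_Icc] at hij
    obtain ⟨⟨hi1, hi2⟩, hj1, hj2⟩ := hij
    rw [lateral_sq_barlowPos_same_layer]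
    have hdi : |((ij.1 : ℝ) - i₀)| ≤ M := by
      rw [show ((ij.1 : ℝ) - i₀) = ((ij.1 - i₀ : ℤ) : ℝ) by push_cast; ring, ← Int.cast_abs]
      exact_mod_cast abs_le.2 ⟨by omega, by omega⟩
    have hdj : |((ij.2 : ℝ) - j₀)| ≤ M := by
      rw [show ((ij.2 : ℝ) - j₀) = ((ij.2 - j₀ : ℤ) : ℝ) by push_cast; ring, ← Int.cast_abs]
      exact_mod_cast abs_le.2 ⟨by omega, by omega⟩
    have hM2 : (2 * a * M) ^ 2 ≤ r ^ 2 := by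
      have h1 : 2 * a * M ≤ r := by
        have := mul_le_mul_of_nonneg_left hMle (show (0 : ℝ) ≤ 2 * a by positivity)
        rwa [mul_div_cancel₀ _ (by positivity : (2 : ℝ) * a ≠ 0)] at this
      exact pow_le_pow_left₀ (by positivity) h1 2
    have hx := abs_le.1 hdi
    have hy := abs_le.1 hdj
    have hx2 : ((ij.1 : ℝ) - i₀) ^ 2 ≤ (M : ℝ) ^ 2 := by nlinarith
    have hy2 : ((ij.2 : ℝ) - j₀) ^ 2 ≤ (M : ℝ) ^ 2 := by nlinarith
    have hxy : ((ij.1 : ℝ) - i₀) * ((ij.2 : ℝ) - j₀) ≤ (M : ℝ) ^ 2 := by nlinarith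
    nlinarith [sq_nonneg a]
  · rw [Finset.card_product, Int.card_Icc, Int.card_Icc]
    have h1 : (i₀ + M + 1 - (i₀ - M)).toNat = 2 * M + 1 := by omega
    have h2 : (j₀ + M + 1 - (j₀ - M)).toNat = 2 * M + 1 := by omega
    rw [h1, h2]
    push_cast
    nlinarith

/-! ## Depth summation over a lateral disc -/

/-- `∑_{k₀ < k ≤ N} (k - k₀)⁻³ ≤ 2`. [folklore] -/
theorem sum_filter_inv_pow_three_shift_le (k₀ N : ℕ) :
    ∑ k ∈ (Finset.range (N + 1)).filter (fun k => k₀ < k), (((k - k₀ : ℕ) : ℝ))⁻¹ ^ 3 ≤ 2 := by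
  set T := (Finset.range (N + 1)).filter (fun k => k₀ < k) with hT
  have hinj : Set.InjOn (fun k => k - k₀) (T : Set ℕ) := by
    intro k hk k' hk' hkk'
    simp only [hT, coe_filter, Set.mem_setOf_eq, Finset.mem_range] at hk hk'
    simp only at hkk'
    omega
  have h1 : ∑ k ∈ T, (((k - k₀ : ℕ) : ℝ))⁻¹ ^ 3 = ∑ j ∈ T.image (fun k => k - k₀), ((j : ℝ))⁻¹ ^ 3 := by
    rw [Finset.sum_image hinj]
  have hsub : T.image (fun k => k - k₀) ⊆ Finset.Icc 1 N := by
    intro j hj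
    obtain ⟨k, hk, rfl⟩ := Finset.mem_image.1 hj
    simp only [hT, Finset.mem_filter, Finset.mem_range] at hk
    rw [Finset.mem_Icc]
    omega
  rw [h1]
  exact (Finset.sum_le_sum_of_subset_of_nonneg hsub fun j _ _ => by positivity).trans
    (sum_Icc_inv_pow_three_le N)

/-- The depth weights `max(k - t₀, 1/2)⁻³`, `k = 0, …, N`, sum to at most `8 t₀ + 18`. [folklore] -/
theorem sum_range_depthWeight_le {t₀ : ℝ} (ht₀ : 0 ≤ t₀) (N : ℕ) :
    ∑ k ∈ Finset.range (N + 1), (max ((k : ℝ) - t₀) (1 / 2))⁻¹ ^ 3 ≤ 8 * t₀ + 18 := by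
  set k₀ : ℕ := ⌊t₀⌋₊ + 1 with hk₀
  have hk₀t : t₀ < k₀ := by rw [hk₀]; push_cast; exact Nat.lt_floor_add_one t₀
  have hk₀le : (k₀ : ℝ) ≤ t₀ + 1 := by
    rw [hk₀]; push_cast; linarith [Nat.floor_le ht₀]
  rw [← Finset.sum_filter_add_sum_filter_not (Finset.range (N + 1)) (fun k => k₀ < k)]
  have hw8 : ∀ k : ℕ, (max ((k : ℝ) - t₀) (1 / 2))⁻¹ ^ 3 ≤ 8 := by
    intro k
    have h1 : (1 / 2 : ℝ) ≤ max ((k : ℝ) - t₀) (1 / 2) := le_max_right _ _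
    have h2 : (max ((k : ℝ) - t₀) (1 / 2))⁻¹ ≤ 2 := by
      rw [inv_le_comm₀ (lt_of_lt_of_le (by norm_num) h1) (by norm_num)]
      linarith
    have h3 : 0 ≤ (max ((k : ℝ) - t₀) (1 / 2))⁻¹ := inv_nonneg.2 (le_trans (by norm_num) h1)
    calc (max ((k : ℝ) - t₀) (1 / 2))⁻¹ ^ 3 ≤ (2 : ℝ) ^ 3 := pow_le_pow_left₀ h3 h2 3
      _ = 8 := by norm_num
  -- the far classes
  have hA : ∑ k ∈ (Finset.range (N + 1)).filter (fun k => k₀ < k),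
      (max ((k : ℝ) - t₀) (1 / 2))⁻¹ ^ 3 ≤ 2 := by
    refine le_trans (Finset.sum_le_sum fun k hk => ?_) (sum_filter_inv_pow_three_shift_le k₀ N)
    simp only [Finset.mem_filter, Finset.mem_range] at hk
    have hkk : (1 : ℝ) ≤ ((k - k₀ : ℕ) : ℝ) := by
      have : 1 ≤ k - k₀ := by omega
      exact_mod_cast this
    have hle : ((k - k₀ : ℕ) : ℝ) ≤ max ((k : ℝ) - t₀) (1 / 2) := by
      refine le_trans ?_ (le_max_left _ _)
      rw [Nat.cast_sub hk.2.le]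
      linarith
    have hpos : (0 : ℝ) < ((k - k₀ : ℕ) : ℝ) := by linarith
    exact pow_le_pow_left₀ (inv_nonneg.2 (hpos.le.trans hle)) (inv_anti₀ hpos hle) 3
  -- the near classes
  have hB : ∑ k ∈ (Finset.range (N + 1)).filter (fun k => ¬ k₀ < k),
      (max ((k : ℝ) - t₀) (1 / 2))⁻¹ ^ 3 ≤ 8 * t₀ + 16 := by
    have hcard : (((Finset.range (N + 1)).filter (fun k => ¬ k₀ < k)).card : ℝ) ≤ t₀ + 2 := by
      have h1 : (Finset.range (N + 1)).filter (fun k => ¬ k₀ < k) ⊆ Finset.range (k₀ + 1) := by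
        intro k hk
        simp only [Finset.mem_filter, Finset.mem_range, not_lt] at hk ⊢
        omega
      have h2 : (((Finset.range (N + 1)).filter (fun k => ¬ k₀ < k)).card : ℝ) ≤ k₀ + 1 := by
        have := Finset.card_le_card h1
        rw [Finset.card_range] at this
        exact_mod_cast this
      linarith
    calc ∑ k ∈ (Finset.range (N + 1)).filter (fun k => ¬ k₀ < k), (max ((k : ℝ) - t₀) (1 / 2))⁻¹ ^ 3
        ≤ ∑ k ∈ (Finset.range (N + 1)).filter (fun k => ¬ k₀ < k), (8 : ℝ) :=
          Finset.sum_le_sum fun k _ => hw8 k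
      _ = (((Finset.range (N + 1)).filter (fun k => ¬ k₀ < k)).card : ℝ) * 8 := by
          rw [Finset.sum_const, nsmul_eq_mul]
      _ ≤ (t₀ + 2) * 8 := by nlinarith
      _ = 8 * t₀ + 16 := by ring
  linarith

/-- **Depth summation over a lateral disc.** Let `S` be a set of indices of layer `m` whose
points lie at lateral distance `≤ r` from `c`, and let `g ≤ A · max(depth - t₀, 1/2)⁻³` on `S`,
`depth = r - (lateral distance)` (`A, t₀ ≥ 0`). Then
`∑_S g ≤ 4 (2r/a + 1)(1/a + 1)(8 t₀ + 18) · A`: the points at depth in `[k, k + 1)` form a unit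
annulus (`≤ 4 (2r/a + 1)(1/a + 1)` of them) and carry weight `≤ A max(k - t₀, 1/2)⁻³`.
[folklore] -/
theorem sum_le_of_lateral_depth_bound (ha : 0 < a) (m : ℤ) (c : EuclideanSpace ℝ (Fin 3))
    {r t₀ A : ℝ} (hr : 0 ≤ r) (ht₀ : 0 ≤ t₀) (hA : 0 ≤ A) (S : Finset (ℤ × ℤ))
    (hS : ∀ ij ∈ S, √((barlowPos a h s m ij.1 ij.2 0 - c 0) ^ 2 +
        (barlowPos a h s m ij.1 ij.2 1 - c 1) ^ 2) ≤ r)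
    (g : ℤ × ℤ → ℝ)
    (hg : ∀ ij ∈ S, g ij ≤ A * (max (r - √((barlowPos a h s m ij.1 ij.2 0 - c 0) ^ 2 +
        (barlowPos a h s m ij.1 ij.2 1 - c 1) ^ 2) - t₀) (1 / 2))⁻¹ ^ 3) :
    ∑ ij ∈ S, g ij ≤ 4 * (2 * r / a + 1) * (1 / a + 1) * (8 * t₀ + 18) * A := by
  classical
  -- lateral distance and depth class
  set ℓ : ℤ × ℤ → ℝ := fun ij => √((barlowPos a h s m ij.1 ij.2 0 - c 0) ^ 2 +
      (barlowPos a h s m ij.1 ij.2 1 - c 1) ^ 2) with hℓ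
  set kk : ℤ × ℤ → ℕ := fun ij => ⌊r - ℓ ij⌋₊ with hkk
  set w : ℕ → ℝ := fun k => (max ((k : ℝ) - t₀) (1 / 2))⁻¹ ^ 3 with hw
  have hw0 : ∀ k, 0 ≤ w k := fun k => by
    simp only [hw]
    exact pow_nonneg (inv_nonneg.2 (le_trans (by norm_num) (le_max_right _ _))) 3
  have hℓ0 : ∀ ij, 0 ≤ ℓ ij := fun ij => Real.sqrt_nonneg _
  -- (1) per index: `g ≤ A w(kk)`
  have h1 : ∀ ij ∈ S, g ij ≤ A * w (kk ij) := by
    intro ij hij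
    refine (hg ij hij).trans (mul_le_mul_of_nonneg_left ?_ hA)
    have hdepth : ((kk ij : ℕ) : ℝ) ≤ r - ℓ ij := Nat.floor_le (by linarith [hS ij hij])
    have hm : max ((kk ij : ℝ) - t₀) (1 / 2) ≤ max (r - ℓ ij - t₀) (1 / 2) :=
      max_le_max (by linarith) le_rfl
    have hpos : (0 : ℝ) < max ((kk ij : ℝ) - t₀) (1 / 2) := lt_of_lt_of_le (by norm_num) (le_max_right _ _)
    exact pow_le_pow_left₀ (inv_nonneg.2 (hpos.le.trans hm)) (inv_anti₀ hpos hm) 3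
  -- (2) fibres are unit annuli
  have hmaps : ∀ ij ∈ S, kk ij ∈ Finset.range (⌊r⌋₊ + 1) := by
    intro ij hij
    rw [Finset.mem_range, Nat.lt_succ_iff]
    exact Nat.floor_le_floor (by linarith [hℓ0 ij])
  have hfiber : ∀ k ∈ Finset.range (⌊r⌋₊ + 1),
      ((S.filter fun ij => kk ij = k).card : ℝ) ≤ 4 * (2 * r / a + 1) * (1 / a + 1) := by
    intro k _
    by_cases hne : (S.filter fun ij => kk ij = k) = ∅
    · rw [hne, Finset.card_empty, Nat.cast_zero]; positivity
    · obtain ⟨ij₀, hij₀⟩ := Finset.nonempty_iff_ne_empty.2 hne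
      rw [Finset.mem_filter] at hij₀
      have hrk : (0 : ℝ) ≤ r - k := by
        have hd : ((kk ij₀ : ℕ) : ℝ) ≤ r - ℓ ij₀ := Nat.floor_le (by linarith [hS ij₀ hij₀.1])
        rw [hij₀.2] at hd
        linarith [hℓ0 ij₀]
      have hshell := card_le_of_lateral_mem_shell' s ha m c (r₁ := r - k - 1) (r₂ := r - k) hrk
        (by linarith) (S.filter fun ij => kk ij = k) (fun ij hij => by
          rw [Finset.mem_filter] at hij
          have hd1 : ((kk ij : ℕ) : ℝ) ≤ r - ℓ ij := Nat.floor_le (by linarith [hS ij hij.1])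
          have hd2 : r - ℓ ij < (kk ij : ℕ) + 1 := Nat.lt_floor_add_one _
          rw [hij.2] at hd1 hd2
          exact ⟨by simp only [hℓ] at hd2 ⊢; linarith, by simp only [hℓ] at hd1 ⊢; linarith⟩)
      refine hshell.trans ?_
      have hk0 : (0 : ℝ) ≤ k := Nat.cast_nonneg k
      have e1 : (r - ↑k - (r - ↑k - 1)) / a + 1 = 1 / a + 1 := by ring
      rw [e1]
      apply mul_le_mul_of_nonneg_right _ (by positivity)
      apply mul_le_mul_of_nonneg_left _ (by norm_num)
      have : 2 * (r - k) / a ≤ 2 * r / a := by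
        apply div_le_div_of_nonneg_right _ ha.le; linarith
      linarith
  -- (3) assemble
  calc ∑ ij ∈ S, g ij ≤ ∑ ij ∈ S, A * w (kk ij) := Finset.sum_le_sum h1
    _ = ∑ k ∈ Finset.range (⌊r⌋₊ + 1), ∑ ij ∈ S.filter (fun ij => kk ij = k), A * w (kk ij) :=
        (Finset.sum_fiberwise_of_maps_to hmaps _).symm
    _ = ∑ k ∈ Finset.range (⌊r⌋₊ + 1), ((S.filter fun ij => kk ij = k).card : ℝ) * (A * w k) := by
        refine Finset.sum_congr rfl fun k _ => ?_
        rw [Finset.sum_congr rfl fun ij hij => by rw [(Finset.mem_filter.1 hij).2], Finset.sum_const,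
          nsmul_eq_mul]
    _ ≤ ∑ k ∈ Finset.range (⌊r⌋₊ + 1), (4 * (2 * r / a + 1) * (1 / a + 1)) * (A * w k) :=
        Finset.sum_le_sum fun k hk =>
          mul_le_mul_of_nonneg_right (hfiber k hk) (mul_nonneg hA (hw0 k))
    _ = (4 * (2 * r / a + 1) * (1 / a + 1) * A) * ∑ k ∈ Finset.range (⌊r⌋₊ + 1), w k := by
        rw [Finset.mul_sum]
        exact Finset.sum_congr rfl fun k _ => by ring
    _ ≤ (4 * (2 * r / a + 1) * (1 / a + 1) * A) * (8 * t₀ + 18) :=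
        mul_le_mul_of_nonneg_left (sum_range_depthWeight_le ht₀ _) (by positivity)
    _ = 4 * (2 * r / a + 1) * (1 / a + 1) * (8 * t₀ + 18) * A := by ring

/-! ## Two layers are lateral translates -/

/-- **Layer `m'` is a lateral translate of layer `m`**: with `L m' = L m + 3c + τ`, the point
`(i, j)` of layer `m'` has the lateral coordinates of the point `(i + c, j + c)` of layer `m`
shifted by `τ w`. [folklore] -/
theorem lateral_barlowPos_eq_of_haggLabel {m m' c τ : ℤ}
    (hL : haggLabel s m' = haggLabel s m + 3 * c + τ) (i j : ℤ) :
    barlowPos a h s m' i j 0 = (barlowPos a h s m (i + c) (j + c) + (τ : ℝ) • barlowOffset a) 0 ∧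
      barlowPos a h s m' i j 1 =
        (barlowPos a h s m (i + c) (j + c) + (τ : ℝ) • barlowOffset a) 1 := by
  constructor
  · simp [barlowOffset, hL]; ring
  · simp [barlowOffset, hL]; ring

/-- The lateral size of `τ w`, `τ ∈ {0, 1, 2}`: `(τ w 0)² + (τ w 1)² = τ² a²/3 ≤ (2a)²`.
[folklore] -/
theorem lateral_sq_smul_barlowOffset_le (a : ℝ) {τ : ℤ} (h0 : 0 ≤ τ) (h2 : τ ≤ 2) :
    (((τ : ℝ) • barlowOffset a) 0) ^ 2 + (((τ : ℝ) • barlowOffset a) 1) ^ 2 ≤ (2 * a) ^ 2 := by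
  have h3 : (√3 : ℝ) ^ 2 = 3 := Real.sq_sqrt (by norm_num)
  have hτ0 : (0 : ℝ) ≤ τ := by exact_mod_cast h0
  have hτ2 : (τ : ℝ) ≤ 2 := by exact_mod_cast h2
  have key : (((τ : ℝ) • barlowOffset a) 0) ^ 2 + (((τ : ℝ) • barlowOffset a) 1) ^ 2 =
      (τ : ℝ) ^ 2 * a ^ 2 / 3 := by
    simp [barlowOffset]
    linear_combination ((τ : ℝ) ^ 2 * a ^ 2 / 36) * h3
  rw [key]
  have hτsq : (τ : ℝ) ^ 2 ≤ 4 := by nlinarith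
  nlinarith [mul_le_mul_of_nonneg_right hτsq (sq_nonneg a), sq_nonneg a, sq_nonneg (τ : ℝ)]

/-- **Disc counts of two layers differ by `O(r)`.** If `S` resp. `S'` are exactly the indices of
the points of layer `m` resp. `m'` at lateral distance `≤ r` from `c` (`r ≥ 0`), then
`|#S' - #S| ≤ 20 (2r/a + 5)`: layer `m'` is layer `m` translated laterally by `τ w`, `|τ w| ≤ 2a`
(and reindexed), so the symmetric difference of the two discs, transported to layer `m`, lies in
the annulus `r - 2a ≤ · ≤ r + 2a` about `c`. [folklore] -/
theorem abs_card_sub_card_lateral_le (ha : 0 < a) (m m' : ℤ) (c : EuclideanSpace ℝ (Fin 3))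
    {r : ℝ} (hr : 0 ≤ r) (S S' : Finset (ℤ × ℤ))
    (hS : ∀ ij, ij ∈ S ↔ (barlowPos a h s m ij.1 ij.2 0 - c 0) ^ 2 +
      (barlowPos a h s m ij.1 ij.2 1 - c 1) ^ 2 ≤ r ^ 2)
    (hS' : ∀ ij, ij ∈ S' ↔ (barlowPos a h s m' ij.1 ij.2 0 - c 0) ^ 2 +
      (barlowPos a h s m' ij.1 ij.2 1 - c 1) ^ 2 ≤ r ^ 2) :
    |(S'.card : ℝ) - S.card| ≤ 20 * (2 * r / a + 5) := by
  classical
  -- write `L m' - L m = 3 q + τ`, `τ ∈ {0, 1, 2}`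
  set δ := haggLabel s m' - haggLabel s m with hδ
  set q := δ / 3 with hq
  set τ := δ % 3 with hτ
  have hτ0 : 0 ≤ τ := Int.emod_nonneg _ (by norm_num)
  have hτ3 : τ ≤ 2 := by have := Int.emod_lt_of_pos δ (by norm_num : (0 : ℤ) < 3); omega
  have hL : haggLabel s m' = haggLabel s m + 3 * q + τ := by
    have := Int.emod_add_mul_ediv δ 3
    omega
  -- lateral projections
  set π : EuclideanSpace ℝ (Fin 3) → EuclideanSpace ℝ (Fin 2) := fun p => !₂[p 0, p 1] with hπ
  set wτ : EuclideanSpace ℝ (Fin 3) := (τ : ℝ) • barlowOffset a with hwτ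
  have hπw : dist (π c) (π (c - wτ)) ≤ 2 * a := by
    rw [hπ]
    dsimp only
    rw [dist_lateral_eq_sqrt]
    calc √((c 0 - (c - wτ) 0) ^ 2 + (c 1 - (c - wτ) 1) ^ 2) = √((wτ 0) ^ 2 + (wτ 1) ^ 2) := by
          congr 1; simp only [PiLp.sub_apply]; ring
      _ ≤ √((2 * a) ^ 2) := Real.sqrt_le_sqrt (lateral_sq_smul_barlowOffset_le a hτ0 hτ3)
      _ = 2 * a := Real.sqrt_sq (by positivity)
  -- the lateral distance of a layer-`m` point to a centre, as a planar distance
  have hdist : ∀ (i j : ℤ) (e : EuclideanSpace ℝ (Fin 3)),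
      dist (π (barlowPos a h s m i j)) (π e) =
        √((barlowPos a h s m i j 0 - e 0) ^ 2 + (barlowPos a h s m i j 1 - e 1) ^ 2) := by
    intro i j e; rw [hπ]; exact dist_lateral_eq_sqrt _ _
  -- membership in `S` as a planar disc condition
  have hSm : ∀ ij : ℤ × ℤ, ij ∈ S ↔ dist (π (barlowPos a h s m ij.1 ij.2)) (π c) ≤ r := by
    intro ij
    rw [hS, hdist, Real.sqrt_le_left hr]
  -- transport `S'` to layer `m`: shift the indices by `q`
  set T : Finset (ℤ × ℤ) := S'.image (fun ij => (ij.1 + q, ij.2 + q)) with hT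
  have hTcard : T.card = S'.card := by
    rw [hT, Finset.card_image_of_injective]
    intro ij ij' hh'
    simp only [Prod.mk.injEq] at hh'
    exact Prod.ext (by omega) (by omega)
  have hT' : ∀ ij : ℤ × ℤ, ij ∈ T ↔ (ij.1 - q, ij.2 - q) ∈ S' := by
    intro ij
    rw [hT, Finset.mem_image]
    constructor
    · rintro ⟨ij', hij', rfl⟩
      simpa using hij'
    · intro hij
      exact ⟨(ij.1 - q, ij.2 - q), hij, by simp⟩
  have hTm : ∀ ij : ℤ × ℤ, ij ∈ T ↔ dist (π (barlowPos a h s m ij.1 ij.2)) (π (c - wτ)) ≤ r := by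
    intro ij
    rw [hT', hS', hdist, Real.sqrt_le_left hr]
    dsimp only
    obtain ⟨h0, h1⟩ :=
      lateral_barlowPos_eq_of_haggLabel (a := a) (h := h) s hL (ij.1 - q) (ij.2 - q)
    simp only [sub_add_cancel] at h0 h1
    rw [h0, h1]
    simp only [hwτ, PiLp.add_apply, PiLp.sub_apply]
    constructor <;> intro H <;> linarith [H]
  -- the symmetric difference lies in the annulus `[r - 2a, r + 2a]` about `c`
  have hann : ∀ ij ∈ (T \ S) ∪ (S \ T),
      r - 2 * a ≤ √((barlowPos a h s m ij.1 ij.2 0 - c 0) ^ 2 +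
          (barlowPos a h s m ij.1 ij.2 1 - c 1) ^ 2) ∧
        √((barlowPos a h s m ij.1 ij.2 0 - c 0) ^ 2 +
          (barlowPos a h s m ij.1 ij.2 1 - c 1) ^ 2) ≤ r + 2 * a := by
    intro ij hij
    rw [← hdist]
    have htri1 := dist_triangle (π (barlowPos a h s m ij.1 ij.2)) (π (c - wτ)) (π c)
    have htri2 := dist_triangle (π (barlowPos a h s m ij.1 ij.2)) (π c) (π (c - wτ))
    rw [dist_comm (π (c - wτ)) (π c)] at htri1
    rcases Finset.mem_union.1 hij with h1 | h1
    · rw [Finset.mem_sdiff, hTm, hSm] at h1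
      constructor <;> linarith [h1.1, not_le.1 h1.2]
    · rw [Finset.mem_sdiff, hTm, hSm] at h1
      constructor <;> linarith [h1.1, not_le.1 h1.2]
  have hcardU : ((((T \ S) ∪ (S \ T)).card : ℕ) : ℝ) ≤ 20 * (2 * r / a + 5) := by
    have h1 := card_le_of_lateral_mem_shell' s ha m c (r₁ := r - 2 * a) (r₂ := r + 2 * a)
      (by positivity) (by linarith) _ hann
    refine h1.trans (le_of_eq ?_)
    field_simp
    ring
  -- `|#T - #S| ≤ #(T \ S) + #(S \ T)`
  have hTS : ((T.card : ℝ) - S.card) = ((T \ S).card : ℝ) - ((S \ T).card : ℝ) := by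
    have h1 := Finset.card_sdiff_add_card_inter T S
    have h2 := Finset.card_sdiff_add_card_inter S T
    rw [Finset.inter_comm] at h2
    have h1' : ((T \ S).card : ℝ) + ((T ∩ S).card : ℝ) = T.card := by exact_mod_cast h1
    have h2' : ((S \ T).card : ℝ) + ((T ∩ S).card : ℝ) = S.card := by exact_mod_cast h2
    linarith
  have hdisj : Disjoint (T \ S) (S \ T) := by
    rw [Finset.disjoint_left]
    intro ij h1 h2
    rw [Finset.mem_sdiff] at h1 h2
    exact h1.2 h2.1
  have hU : (((T \ S) ∪ (S \ T)).card : ℝ) = ((T \ S).card : ℝ) + ((S \ T).card : ℝ) := by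
    exact_mod_cast Finset.card_union_of_disjoint hdisj
  rw [← hTcard, hTS, abs_le]
  have h0 : (0 : ℝ) ≤ ((T \ S).card : ℝ) := Nat.cast_nonneg _
  have h0' : (0 : ℝ) ≤ ((S \ T).card : ℝ) := Nat.cast_nonneg _
  constructor <;> linarith

end Layer

end Literature.MathematicalPhysics.StatisticalMechanics

end
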